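import Summits.ResolutionOfSingularities.ResolutionOfSingularities.Theorems.AbhyankarShadowsShadowsUniformizeLurelComposite
import Summits.ResolutionOfSingularities.ResolutionOfSingularities.Theorems.AbhyankarShadowsShadowsUniformizeAbhyankarResidueTransport
import Summits.ResolutionOfSingularities.ResolutionOfSingularities.Theorems.AbhyankarShadowsShadowsUniformizeDenseResidueTransport
import Summits.ResolutionOfSingularities.ResolutionOfSingularities.Theorems.AbhyankarShadowsShadowsUniformizeCompositeResidueAbhyankar
import Summits.ResolutionOfSingularities.ResolutionOfSingularities.Theorems.AbhyankarShadowsShadowsUniformizeCompositeResidueDense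
import HarnessLib

/-!
# Relative local uniformization at composite rational places whose residue valuation is discrete, Abhyankar or dense-Abhyankar: the composite-uniformizable branch of `ShadowsUniformize`

Composite-uniformizable branch of the birth line of the crux `ShadowsUniformize` (route
`AbhyankarShadows`, item stmt-ResolutionOfSingularities-16756), lead c3 (reshape #4): the typed
assembly `lurelRational_of_isCompositeUniformizable`, widening the c2 branch
`lurelRational_of_isCompositeDiscrete` (discrete residue valuation only).

**Theorem.** Let `k` be algebraically closed of characteristic `p`, `K/k` finitely generated,
`O ∋ k` a RATIONAL valuation ring of `K`, and suppose `O` has a coarsening `O₁ ⊇ O` which is an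
Abhyankar place of `K/k` — or lies in the completion of a finitely generated Abhyankar
subextension (Knaf–Kuhlmann 2009, Thm. 1.5) — such that the residue valuation ring
`O₂ = O / 𝔪_{O₁} ⊆ κ(O₁)` (`residueValuationSubring`) EITHER has cyclic value group OR, read
through some `k`-compatible field isomorphism `ι : κ → κ(O₁)` from a field `κ` with a `k`-algebra
structure, is an Abhyankar place of `κ/k` or lies in the completion of a finitely generated
Abhyankar subextension of `κ/k`. Then every finitely generated `R ⊆ O` is dominated by a finitely
generated `A ⊆ O` with `Frac A = K`, regular at the centre of `O`.

Example beyond the c2 loci (transcendence degree `4`): `O = O₁ ∘ ν₂` with `O₁` a prime divisor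
of `K` and `ν₂` a rank-one rational valuation of the residue threefold `κ(O₁)` with value group
`ℤ + ℤ√2` lying in the completion of an Abhyankar surface subfield — `O` has rank `2` and rational
rank `3`, so it is neither Abhyankar nor discrete; it is not composite-discrete (its proper
coarsenings are `O₁`, with non-discrete residue valuation, and `K`); and it is not itself in the
completion of an Abhyankar subfunction field `K₀` (density makes `K | K₀` immediate, so
`trdeg K₀ = 3` and `κ(O₁ ∩ K₀) = κ(O₁)` has transcendence degree `3`, forcing `O₁ ∩ K₀ = K₀` by
Abhyankar's inequality, against `v(t) ∈ vK = vK₀` for a uniformizer `t` of `O₁`).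

Proof: the per-valuation Novacoski–Spivakovsky composition (`stub_lurel_of_composite`, landed
c2) with (i) relative local uniformization of the coarsening (`relLU_at_abhyankarPlace_of_perfectField`
/ `lurelRational_of_isDenseAbhyankar`), (ii) finite generation of `κ(O₁)` by residues of
elements of `O` (`stub_residue_gen_unfolded`), (iii) relative local uniformization of
`ι'⁻¹(O₂)` for EVERY `k`-compatible surjective `ι' : κ' → κ(O₁)`: the discrete case is
`stub_composite_residue_discrete` (c2); in the Abhyankar / dense-Abhyankar cases the hypothesis
given for ONE `ι₀ : κ₀ → κ(O₁)` is moved to `ι'` (`stub_isAbhyankarPlace_residue_transport`,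
`stub_isDenseAbhyankar_residue_transport`; the `k`-compatibility `ι₀ ∘ algebraMap = ι' ∘ algebraMap`
holds because both are the residues of the constants) and discharged by
`stub_composite_residue_abhyankar` (Knaf–Kuhlmann 2005 Thm. 1.1 on `κ'`) /
`stub_composite_residue_dense` (Knaf–Kuhlmann 2009 Thm. 1.5 on `κ'`).

## Sources

* J. Novacoski, M. Spivakovsky, *Reduction of local uniformization to the rank one case*,
  EMS Ser. Congr. Rep. (2014) = arXiv:1204.4751: Thm. 1.1, §3.1. [NovacoskiSpivakovsky2014]
* H. Knaf, F.-V. Kuhlmann, Ann. Sci. ÉNS 38 (2005): Thm. 1.1, Cor. 2.2 [KnafKuhlmann2005];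
  Adv. Math. 221 (2009): Thm. 1.5 [KnafKuhlmann2009].
-/

noncomputable section

-- single-problem summit: the doubled namespace component is forced
set_option linter.dupNamespace false

open Literature.AlgebraicGeometry.Resolution IsLocalRing

namespace Summit.ResolutionOfSingularities.ResolutionOfSingularities.Theorems

/-- **Relative local uniformization at composite rational places `ν = ν₁ ∘ ν₂` with `ν₁`
Abhyankar or dense-Abhyankar and `ν₂` discrete, Abhyankar or dense-Abhyankar** (typed, in the
vocabulary of the crux `ShadowsUniformize` / the target `LurelRational`): for `k` algebraically
closed of characteristic `p`, `K/k` finitely generated, `O ∋ k` a rational valuation ring of `K`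
with a coarsening `O₁ ⊇ O` that is an Abhyankar place of `K/k` or lies in the completion of a
finitely generated Abhyankar subextension, and whose residue valuation ring `O / 𝔪_{O₁}` has
cyclic value group or — through a `k`-compatible surjective `ι : κ → κ(O₁)` — is an Abhyankar
place of `κ/k` or lies in the completion of a finitely generated Abhyankar subextension of `κ/k`,
every finitely generated `R ⊆ O` is dominated by a finitely generated `A ⊆ O`, `Frac A = K`,
regular at the centre of `O`. (Novacoski–Spivakovsky composition of the landed branches.)
[cite: NovacoskiSpivakovsky2014, Thm. 1.1] -/
theorem lurelRational_of_isCompositeUniformizable :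
    ∀ p : ℕ, p.Prime → ∀ (k K : Type) [Field k] [CharP k p] [IsAlgClosed k] [Field K]
      [Algebra k K], (⊤ : IntermediateField k K).FG → ∀ O : ValuationSubring K,
      (∀ c : k, algebraMap k K c ∈ O) →
      (∀ x : K, x ∈ O → ∃ c : k, O.valuation (x - algebraMap k K c) < 1) →
      (∃ (O₁ : ValuationSubring K) (hO : O ≤ O₁),
        (IsAbhyankarPlace O₁ (algebraMap k K).fieldRange ⊤ ∨
          ∃ K₀ : IntermediateField k K, K₀.FG ∧
            IsAbhyankarPlace O₁ (algebraMap k K).fieldRange K₀.toSubfield ∧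
              IsDenseIn O₁ K₀.toSubfield ⊤) ∧
        (IsCyclic ((residueValuationSubring O O₁ hO).ValueGroup)ˣ ∨
          ∃ (κ : Type) (_ : Field κ) (_ : Algebra k κ) (ι : κ →+* IsLocalRing.ResidueField O₁),
            Function.Surjective ι ∧
            (∀ (c : k) (hc : algebraMap k K c ∈ O₁),
              ι (algebraMap k κ c) = IsLocalRing.residue O₁ ⟨algebraMap k K c, hc⟩) ∧
            (IsAbhyankarPlace ((residueValuationSubring O O₁ hO).comap ι)
                (algebraMap k κ).fieldRange ⊤ ∨
              ∃ κ₀ : IntermediateField k κ, κ₀.FG ∧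
                IsAbhyankarPlace ((residueValuationSubring O O₁ hO).comap ι)
                  (algebraMap k κ).fieldRange κ₀.toSubfield ∧
                IsDenseIn ((residueValuationSubring O O₁ hO).comap ι) κ₀.toSubfield ⊤))) →
      ∀ R : Subalgebra k K, R.FG → R.toSubring ≤ O.toSubring →
      ∃ (A : Subalgebra k K) (h : A.toSubring ≤ O.toSubring), R ≤ A ∧ A.FG ∧
        IsFractionRing A K ∧ IsRegularLocalRing
          (Localization.AtPrime (Ideal.comap (Subring.inclusion h) (IsLocalRing.maximalIdeal O))) := by
  intro p hp k K _ _ _ _ _ hfg O hk hrat hU R hR hRO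
  obtain ⟨O₁, hO, hA₁, hres⟩ := hU
  have hk₁ : ∀ c : k, algebraMap k K c ∈ O₁ := fun c => hO (hk c)
  -- (i) relative local uniformization of the coarsening
  have hLU₁ : ∀ R : Subalgebra k K, R.FG → R.toSubring ≤ O₁.toSubring →
      ∃ (A : Subalgebra k K) (h : A.toSubring ≤ O₁.toSubring), R ≤ A ∧ A.FG ∧
        IsFractionRing A K ∧ IsRegularLocalRing
          (Localization.AtPrime (Ideal.comap (Subring.inclusion h) (IsLocalRing.maximalIdeal O₁))) := by
    intro R' hR' hR'O
    rcases hA₁ with hA₁ | hD₁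
    · exact relLU_at_abhyankarPlace_of_perfectField hfg O₁ hk₁ hA₁ R' hR' hR'O
    · exact lurelRational_of_isDenseAbhyankar p hp k K hfg O₁ hk₁ hD₁ R' hR' hR'O
  -- (ii) the residue field of the coarsening is generated by residues of elements of `O`
  have hgen := stub_residue_gen_unfolded k K hfg O O₁ hO hk hA₁
  -- (iii) the residue valuation through every `ι`, and the composition
  refine stub_lurel_of_composite k K hfg O O₁ hO hk hgen hLU₁ ?_ R hR hRO
  intro κ _ _ ι hι hιk R' hR' hR'O
  rcases hres with hcyc | ⟨κ₀, _, _, ι₀, hι₀, hι₀k, hres₀⟩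
  · exact stub_composite_residue_discrete p hp k K O O₁ hO hk hrat hgen hcyc κ ι hι hιk R' hR' hR'O
  · have hcompat : ∀ c : k, ι₀ (algebraMap k κ₀ c) = ι (algebraMap k κ c) := fun c => by
      rw [hι₀k c (hO (hk c)), hιk c]
    rcases hres₀ with hA₀ | hD₀
    · exact stub_composite_residue_abhyankar k K O O₁ hO hk hgen κ ι hι hιk
        (stub_isAbhyankarPlace_residue_transport k κ₀ κ _ (residueValuationSubring O O₁ hO)
          ι₀ ι hι₀ hι hcompat hA₀) R' hR' hR'O
    · exact stub_composite_residue_dense p hp k K O O₁ hO hk hgen κ ι hι hιk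
        (stub_isDenseAbhyankar_residue_transport k κ₀ κ _ (residueValuationSubring O O₁ hO)
          ι₀ ι hι₀ hι hcompat hD₀) R' hR' hR'O

end Summit.ResolutionOfSingularities.ResolutionOfSingularities.Theorems

end
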